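import Summits.CriticalPhenomena.PercolationContinuityZ3.Theorems.Transplant.SiteStarH
import Summits.CriticalPhenomena.PercolationContinuityZ3.Theorems.Transplant.SiteHtwBridge
import HarnessLib

/-!
# SITE percolation: the one-source bounds (★^H)_site and (Y^H ≤ H)_site IN THE VOCABULARY OF META-A2 (`SiteCovTau.Yw / Mav / BfS`),
# and site LEMMA H unconditionally (WP3 step 2 of P1-SITE-Z3 §16, closing WP3; site twin of `…CovTauStarBridgeS.lean`)

builds on p205010 (kernel theorem, internal audit signed; external expert review pending).

The site two-source induction META-A2 / A2^H / (Htw)_site (`SiteCovTau.metaA2`, `a2H_of_star`, p212506–p213051) and site LEMMA H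
(`SiteCovTau.siteHpart_nonneg_of_star`, p213207) take as hypotheses, for every sub-world `U'` and every source set `N`, the ONE-SOURCE bounds
* `hstar : Yw Γ q U' x (U'' ↦ H_{G[U'']}) N · Mav Γ q U' S v ∅ ≤ Mav Γ q U' S v N · H_{G[U']}` — Lemma (★^H)_site, and
* `hYB  : Yw Γ q U' x (U'' ↦ H_{G[U'']}) {u} ≤ H_{G[U']}` — (Y^H ≤ H)_site,
with `H_{G[U']} = BfS Γ q U' x S v g = Cov_{G[U']}(g(C_x), 1{v ↔ S})`.  THIS FILE discharges both (`SiteStarH.yS_mul_mS_le`, `SiteStarH.yS_le_bS`)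
from the finitary forms `SiteStarH.starS_ED` / `SiteStarH.yS_le_covS` through the dictionary weight-sums over `Set V` ↔ `DecisionTree.ED` on the
coordinates `U` (`sum_weight_restrict`), `SiteBHK.srest U N = U ∖ S_N` (`srest_coe_eq_sdiff`: the landed site world IS the complement of the set
revealed by the site exploration), `Mav_eq_ED`, `BfS_eq_covS`, `Yw_BfS_eq_yS`; and concludes **`SiteCovTau.siteHpart_nonneg`** — site LEMMA H
`Hpart ≥ 0` with NO remaining hypothesis (from (K6)_site p211167, site META-A2, and the bounds of this file).  All OURS (print: bond only).
Support file (`--supports stmt-CriticalPhenomena-4575 --as helper`); no definitions, no named facts, no sorries.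
[cite: VandenbergHaggstromKahn2005, Thm. 1.1 (pp. 3–5), Thm. 1.4 (p. 7), eq. (6) (p. 4)] [cite: Gladkov2024, Thm. 3.2 (p. 4)]
[cite: KozmaNitzan2024, Conj. 4 (p. 32)]
-/

noncomputable section

open Classical

namespace Summit.CriticalPhenomena.PercolationContinuityZ3.Theorems.Transplant

namespace SiteStarH

open Finset MeasureTheory
open Literature.Probability.Percolation
open Literature.Probability.Percolation.BHK2006 (weight)
open Literature.Probability.Percolation.DecisionTree
open SiteBHK (sC sD srest setC mem_sC_comm sC_mono mem_srest mem_setC)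
open SiteSetExploration
open SiteCovTau (Yw Mav BfS tfS cfS)
open CovTauStarN (ED_congr_on ED_sub srcF mem_srcF)

variable {V : Type*} [Fintype V] [DecidableEq V] {Γ : SimpleGraph V}

/-! ### Weight-sums over `Set V` of functions of `ω ∩ U` are `ED U`-expectations -/

/-- **Restriction**: a `weight`-sum of a function of `ω ∩ U` is an `ED U`-expectation (marginal identity `CovTauStarN.ED_inter_eq`).
[cite: VandenbergHaggstromKahn2005, §1 p. 3 (the restricted model)] -/
theorem sum_weight_restrict (q : V → ℝ) (U : Finset V) (φ : Set V → ℝ) (hφ : ∀ ω, φ ω = φ (ω ∩ ↑U)) :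
    ∑ ω, weight q ω * φ ω = ED U q (fun K => φ ↑K) := by
  rw [CovTauStarN.sum_weight_mul_eq_ED]
  have h1 : (fun K : Finset V => φ ↑K) = fun K => (fun K' : Finset V => φ ↑K') (K ∩ U) := by
    funext K; dsimp only; rw [Finset.coe_inter, ← hφ]
  have h2 := CovTauStarN.ED_inter_eq (Finset.subset_univ U) q (fun K' : Finset V => φ ↑K')
  rw [← h1] at h2
  exact h2

/-! ### Dictionary: events and functionals on the configurations `K ⊆ U` -/

omit [Fintype V] [DecidableEq V] in
/-- `1{v ↔ S in G[U]}` on a finite configuration is `nS`. [folklore] -/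
theorem ind_compl_sD_eq_nS (U : Finset V) (v : V) (S : Finset V) (K : Finset V) :
    ind (sD Γ U v (↑S : Set V))ᶜ (↑K : Set V) = nS Γ U S v K := by
  unfold nS
  refine BystanderBHK.ind_congr ?_
  simp only [Set.mem_compl_iff, sD, Set.mem_setOf_eq, not_forall, not_not, Finset.mem_coe, exists_prop]

omit [Fintype V] [DecidableEq V] in
/-- `1{v ↮ S ∪ N in G[U]}` on a finite configuration is `(1 − nS S)(1 − nS N)`. [folklore] -/
theorem ind_sD_union_eq (U : Finset V) (v : V) (S N : Finset V) (K : Finset V) :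
    ind (sD Γ U v ((↑S : Set V) ∪ ↑N)) (↑K : Set V) = (1 - nS Γ U S v K) * (1 - nS Γ U N v K) := by
  unfold nS
  have hmem : (↑K : Set V) ∈ sD Γ U v ((↑S : Set V) ∪ ↑N) ↔
      (¬ ∃ s ∈ S, s ∈ sC Γ U v (↑K : Set V)) ∧ ¬ ∃ s ∈ N, s ∈ sC Γ U v (↑K : Set V) := by
    simp only [sD, Set.mem_setOf_eq, Set.mem_union, Finset.mem_coe, or_imp, forall_and, not_exists, not_and]
  by_cases h1 : ∃ s ∈ S, s ∈ sC Γ U v (↑K : Set V)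
  · rw [ind_of_mem (show K ∈ {L : Finset V | ∃ s ∈ S, s ∈ sC Γ U v (↑L : Set V)} from h1),
      ind_of_not_mem (show (↑K : Set V) ∉ sD Γ U v ((↑S : Set V) ∪ ↑N) from fun h => (hmem.1 h).1 h1)]
    ring
  · rw [ind_of_not_mem (show K ∉ {L : Finset V | ∃ s ∈ S, s ∈ sC Γ U v (↑L : Set V)} from h1)]
    by_cases h2 : ∃ s ∈ N, s ∈ sC Γ U v (↑K : Set V)
    · rw [ind_of_mem (show K ∈ {L : Finset V | ∃ s ∈ N, s ∈ sC Γ U v (↑L : Set V)} from h2),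
        ind_of_not_mem (show (↑K : Set V) ∉ sD Γ U v ((↑S : Set V) ∪ ↑N) from fun h => (hmem.1 h).2 h2)]
      ring
    · rw [ind_of_not_mem (show K ∉ {L : Finset V | ∃ s ∈ N, s ∈ sC Γ U v (↑L : Set V)} from h2),
        ind_of_mem (hmem.2 ⟨h1, h2⟩)]
      ring

omit [DecidableEq V] in
/-- A `Set` source set and its `Finset` version give the same avoidance event. [folklore] -/
theorem sD_srcF (U : Finset V) (v : V) (X : Set V) : sD Γ U v (↑(srcF X) : Set V) = sD Γ U v X := by
  ext ω; simp only [sD, Set.mem_setOf_eq, Finset.mem_coe, mem_srcF]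

/-- **The landed site world is the complement of the revealed set**: for a configuration `K`,
`srest Γ U N K = U ∖ S_N(K)` (sources, cluster and vertex boundary are exactly what the site exploration reveals). [cite: VandenbergHaggstromKahn2005, eq. (6) (p. 4)] -/
theorem srest_coe_eq_sdiff (U : Finset V) (N : Set V) (K : Finset V) :
    srest Γ U N (↑K : Set V) = U \ revealedAt Γ U (srcF N) K := by
  have hRC : ∀ w, w ∈ reached Γ U (srcF N) K ↔ w ∈ setC Γ U N (↑K : Set V) := fun w => by
    rw [mem_reached_iff, mem_setC]
    simp only [mem_srcF]
  ext u
  rw [mem_srest, Finset.mem_sdiff]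
  constructor
  · rintro ⟨huU, huN, huC, hadj⟩
    refine ⟨huU, fun hrev => ?_⟩
    rcases (mem_revealedAt_iff.1 hrev).2 with hN | ⟨r, hr, hru⟩
    · exact huN (mem_srcF.1 hN)
    · exact hadj r ((hRC r).1 hr) hru.symm
  · rintro ⟨huU, hrev⟩
    refine ⟨huU, fun huN => hrev (mem_revealedAt_iff.2 ⟨huU, Or.inl (mem_srcF.2 huN)⟩),
      fun huC => hrev (mem_of_mem_reached ((hRC u).2 huC)).1,
      fun c hc huc => hrev (mem_revealedAt_iff.2 ⟨huU, Or.inr ⟨c, (hRC c).2 hc, huc.symm⟩⟩)⟩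

/-- `1{x ↮ N in G[U]}(K) = 1{x ∉ C_N(K)}`. [folklore] -/
theorem ind_sD_eq_ind_not_reached (U : Finset V) (x : V) (N : Set V) (K : Finset V) :
    ind (sD Γ U x N) (↑K : Set V) = ind {L : Finset V | x ∉ reached Γ U (srcF N) L} K := by
  refine BystanderBHK.ind_congr ?_
  rw [Set.mem_setOf_eq, mem_reached_iff, ← SiteBHK.not_mem_setC_iff, mem_setC]
  simp only [mem_srcF]

/-! ### `Mav`, `BfS`, `Yw` as `ED`-expressions -/

/-- `Mav Γ q U S v N = E[(1 − nS S)(1 − nS N)]` on the coordinates `U`. [folklore] -/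
theorem Mav_eq_ED (q : V → ℝ) (U : Finset V) (S : Set V) (v : V) (N : Set V) :
    Mav Γ q U S v N = ED U q (fun K => (1 - nS Γ U (srcF S) v K) * (1 - nS Γ U (srcF N) v K)) := by
  unfold Mav
  rw [sum_weight_restrict q U _ (fun ω =>
    BystanderBHK.ind_congr (SiteBHK.mem_sD_inter U v _ ω ↑U subset_rfl).symm)]
  refine ED_congr_on U q fun K _ => ?_
  rw [← ind_sD_union_eq, ← sD_srcF U v (S ∪ N)]
  congr 2
  ext u; simp only [Finset.mem_coe, mem_srcF, Set.mem_union]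

/-- `Mav Γ q U S v ∅ = E[1 − nS S]`. [folklore] -/
theorem Mav_empty_eq_ED (q : V → ℝ) (U : Finset V) (S : Set V) (v : V) :
    Mav Γ q U S v ∅ = ED U q (fun K => 1 - nS Γ U (srcF S) v K) := by
  rw [Mav_eq_ED]
  refine ED_congr_on U q fun K _ => ?_
  have : nS Γ U (srcF (∅ : Set V)) v K = 0 := ind_of_not_mem fun ⟨s, hs, _⟩ => by
    rw [mem_srcF] at hs; exact hs
  rw [this]; ring

/-- **`BfS` in a sub-world `W ⊆ U` is `covS` on the coordinates `U`.** [folklore] -/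
theorem BfS_eq_covS (q : V → ℝ) {U W : Finset V} (hW : W ⊆ U) (x : V) (S : Set V) (v : V) (g : Set V → ℝ) :
    BfS Γ q W x S v g = covS Γ U q g x (srcF S) v W := by
  have hWU : (↑W : Set V) ⊆ ↑U := Finset.coe_subset.2 hW
  have hC : ∀ ω : Set V, sC Γ W x (ω ∩ ↑U) = sC Γ W x ω := fun ω => SiteBHK.sC_inter W x ω ↑U hWU
  have hD : ∀ ω : Set V, ind (sD Γ W v S)ᶜ (ω ∩ ↑U) = ind (sD Γ W v S)ᶜ ω := fun ω =>
    BystanderBHK.ind_congr (by rw [Set.mem_compl_iff, Set.mem_compl_iff, SiteBHK.mem_sD_inter W v S ω ↑U hWU])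
  have h1 : ∑ ω, weight q ω * (g (sC Γ W x ω) * ind (sD Γ W v S)ᶜ ω) =
      ED U q (fun K => fS Γ W g x K * nS Γ W (srcF S) v K) := by
    rw [sum_weight_restrict q U _ (fun ω => by rw [hC, hD])]
    refine ED_congr_on U q fun K _ => ?_
    rw [← sD_srcF W v S, ind_compl_sD_eq_nS]; rfl
  have h2 : tfS Γ q W x g = ED U q (fS Γ W g x) := by
    unfold tfS
    rw [sum_weight_restrict q U _ (fun ω => by rw [hC])]
    rfl
  have h3 : cfS Γ q W S v = ED U q (nS Γ W (srcF S) v) := by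
    unfold cfS
    rw [sum_weight_restrict q U _ (fun ω => by rw [hD])]
    refine ED_congr_on U q fun K _ => ?_
    rw [← sD_srcF W v S, ind_compl_sD_eq_nS]
  unfold BfS covS
  rw [h1, h2, h3]

/-- **`Yw` of the world functional `U' ↦ H_{G[U']}(v)` is `yS`** on the coordinates `U`. [folklore] -/
theorem Yw_BfS_eq_yS (q : V → ℝ) (U : Finset V) (x : V) (S : Set V) (v : V) (g : Set V → ℝ) (N : Set V) :
    Yw Γ q U x (fun U' => BfS Γ q U' x S v g) N = yS Γ U q g x (srcF S) v (srcF N) := by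
  unfold Yw yS
  rw [sum_weight_restrict q U _ (fun ω => by
    rw [SiteCovTau.srest_inter, BystanderBHK.ind_congr (SiteBHK.mem_sD_inter U x N ω ↑U subset_rfl).symm])]
  refine ED_congr_on U q fun K _ => ?_
  dsimp only
  rw [srest_coe_eq_sdiff, BfS_eq_covS q Finset.sdiff_subset, ind_sD_eq_ind_not_reached, mul_comm]

/-! ### The one-source bounds in META-A2 vocabulary -/

/-- **(★^H)_site in every world `G[U]`, META-A2 vocabulary**: `Yw·Mav ∅ ≤ Mav N·H` for the world functional
`U' ↦ H_{G[U']}(v) = Cov_{G[U']}(g(C_x), 1{v ↔ S})`, `x ∈ S` — the hypothesis `hstar` of `SiteCovTau.a2H_of_star` / `siteHpart_nonneg_of_star`,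
discharged by `SiteStarH.starS_ED`.  OURS (site); no `v ∉ S` needed. [cite: Gladkov2024, Thm. 3.2 (p. 4)]
[cite: VandenbergHaggstromKahn2005, Thm. 1.4 (p. 7), eq. (6) (p. 4)] -/
theorem yS_mul_mS_le (q : V → ℝ) (hq0 : ∀ u, 0 ≤ q u) (hq1 : ∀ u, q u ≤ 1) {x v : V} {S : Set V} (hxS : x ∈ S)
    {g : Set V → ℝ} (hg : Monotone g) (hg0 : ∀ C, 0 ≤ g C) (U : Finset V) (N : Set V) :
    Yw Γ q U x (fun U' => BfS Γ q U' x S v g) N * Mav Γ q U S v ∅ ≤ Mav Γ q U S v N * BfS Γ q U x S v g := by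
  rw [Yw_BfS_eq_yS, Mav_empty_eq_ED, Mav_eq_ED, BfS_eq_covS q subset_rfl]
  exact starS_ED U (srcF N) x v (srcF S) g hq0 hq1 (mem_srcF.2 hxS) hg hg0

/-- **`Y^H ≤ H` in every world `G[U]`, META-A2 vocabulary** (site): the hypothesis `hYB` of `SiteCovTau.a2H_of_star` /
`siteHpart_nonneg_of_star`, discharged by `SiteStarH.yS_le_covS` (decision-tree Harris alone). OURS (site). [cite: Gladkov2024, Thm. 3.2 (p. 4)] -/
theorem yS_le_bS (q : V → ℝ) (hq0 : ∀ u, 0 ≤ q u) (hq1 : ∀ u, q u ≤ 1) (x v : V) (S : Set V)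
    {g : Set V → ℝ} (hg : Monotone g) (hg0 : ∀ C, 0 ≤ g C) (U : Finset V) (N : Set V) :
    Yw Γ q U x (fun U' => BfS Γ q U' x S v g) N ≤ BfS Γ q U x S v g := by
  rw [Yw_BfS_eq_yS, BfS_eq_covS q subset_rfl]
  exact yS_le_covS U (srcF N) x v (srcF S) g hq0 hq1 hg hg0

end SiteStarH

namespace SiteCovTau

open MeasureTheory Set
open Literature.Probability.LatticeModels (prodBernoulli)
open Literature.Probability.Percolation
open Summit.CriticalPhenomena.PercolationContinuityZ3.Theorems.SiteTransplant (siteConn)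
open SiteCSH (worldQ)

variable {n : ℕ} {Δ : SimpleGraph (Fin n)}

/-- **LEMMA H (site), unconditional**: the H-part of the site within-margin unfolding is nonnegative — from (K6)_site (p211167), the site
two-source inequality META-A2 / (Htw)_site (p212506–p213207) and the site one-source bounds (★^H)_site / (Y^H ≤ H)_site of this file.  OURS; exactly
the statement of `siteHpart_nonneg_of_star` with its two hypotheses discharged (the `hU` input of `SiteCSH.siteCSHAll_of_unfold`, H-part).
[cite: VandenbergHaggstromKahn2005, Thm. 1.4 (p. 7)] [cite: KozmaNitzan2024, Conj. 4 (p. 32)] -/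
theorem siteHpart_nonneg (q : Fin n → unitInterval) (hq : ∀ u, 0 < q u ∧ q u < 1) (x : Fin n) (Y : Set (Fin n))
    (S : Finset (Fin n)) (hxS : x ∈ S) (o v : Fin n) (g : Set (Fin n) → ℝ)
    (hg : ∀ C C' : Set (Fin n), C ⊆ C' → g C ≤ g C') (hg0 : ∀ C, 0 ≤ g C) :
    0 ≤ ∫ ω in {ω : Set (Fin n) | ∀ y ∈ Y, y ∉ siteCluster Δ ω x},
      (((∫ η in (⋃ t ∈ S, siteConn Δ o t), g (siteCluster Δ η x) ∂(prodBernoulli (worldQ Δ q Y ω))) -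
          (prodBernoulli (worldQ Δ q Y ω)).real (⋃ t ∈ S, siteConn Δ o t) *
            (∫ η, g (siteCluster Δ η x) ∂(prodBernoulli (worldQ Δ q Y ω)))) -
        SiteCSH.obsConst Δ q o v (↑S ∪ Y) *
          ((∫ η in (⋃ t ∈ S, siteConn Δ v t), g (siteCluster Δ η x) ∂(prodBernoulli (worldQ Δ q Y ω))) -
            (prodBernoulli (worldQ Δ q Y ω)).real (⋃ t ∈ S, siteConn Δ v t) *
              (∫ η, g (siteCluster Δ η x) ∂(prodBernoulli (worldQ Δ q Y ω)))))
      ∂(prodBernoulli q) := by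
  have hq0 : ∀ u, 0 ≤ (q u : ℝ) := fun u => (q u).2.1
  have hq1 : ∀ u, (q u : ℝ) ≤ 1 := fun u => (q u).2.2
  have hgm : Monotone g := fun C C' h => hg C C' h
  exact siteHpart_nonneg_of_star q hq x Y S hxS o v g hg hg0
    (fun U' N _ => SiteStarH.yS_mul_mS_le (Γ := Δ) (fun u => (q u : ℝ)) hq0 hq1 (Finset.mem_coe.2 hxS) hgm hg0 U' N)
    (fun U' u => SiteStarH.yS_le_bS (Γ := Δ) (fun u => (q u : ℝ)) hq0 hq1 x v (↑S : Set (Fin n)) hgm hg0 U' {u})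

end SiteCovTau

end Summit.CriticalPhenomena.PercolationContinuityZ3.Theorems.Transplant
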